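import Mathlib
import Literature.Probability.LatticeModels.IsoradialPercolation
import Literature.Probability.Percolation.PercolationProofs
import HarnessLib

/-! # Crux `PercNearOneGluing.AdditiveGluing` (stmt-CriticalPhenomena-4576), line `starglue/tieline` —
stub `stub_exchangePlain_c7`: the plain exchange step (Kozma–Nitzan Lemma 3, trivial part)

For the bond percolation measure `μ = prodBernoulli w` of a finite weighted graph on `Fin n` and
vertices `x, y, b`: if `μ(x ↔ b) ≤ μ(y ↔ b)` then `μ(x ↔ b, x ↮ y) ≤ μ(y ↔ b, x ↮ y)`
(Kozma–Nitzan, arXiv:2401.12397, Lemma 3 (pp. 6–7), the bookkeeping step common to parts (i) and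
(ii): removing the common part on `{x ↔ y}`).

## Proof

On the event `{x ↔ y}` the events `{x ↔ b}` and `{y ↔ b}` coincide (transitivity and symmetry of
`SimpleGraph.Reachable` in the open subgraph), i.e. `{x ↔ b} \ {x ↮ y} = {y ↔ b} \ {x ↮ y}`
(`exchangePlain_sdiff_eq`).  Splitting both sides of the hypothesis along the (measurable) event
`{x ↮ y}` with `measureReal_inter_add_sdiff`,
`μ(x ↔ b) = μ(x ↔ b, x ↮ y) + μ({x ↔ b} \ {x ↮ y})` and likewise for `y`, the second summands agree,
so the first summands compare as claimed (`linarith`).  No new definitions.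
-/

namespace Summit.CriticalPhenomena.PercolationContinuityZ3.Theorems

open MeasureTheory Set Literature.Probability.LatticeModels Literature.Probability.Percolation

noncomputable section
open Classical

/-- On `{x ↔ y}` the events `{x ↔ b}` and `{y ↔ b}` coincide:
`{x ↔ b} \ {x ↮ y} = {y ↔ b} \ {x ↮ y}` (transitivity and symmetry of open connection). [folklore] -/
theorem exchangePlain_sdiff_eq {V : Type*} (x y b : V) :
    (openConn x b : Set (BondConfig V)) \ (openConn x y)ᶜ = openConn y b \ (openConn x y)ᶜ := by
  ext ω
  simp only [mem_sdiff, mem_compl_iff, not_not, openConn, mem_setOf_eq]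
  constructor
  · rintro ⟨h1, h2⟩
    exact ⟨h2.symm.trans h1, h2⟩
  · rintro ⟨h1, h2⟩
    exact ⟨h2.trans h1, h2⟩

/-- **Plain exchange step** (registered stub `stub_exchangePlain_c7` of line `starglue/tieline`;
Kozma–Nitzan Lemma 3, trivial part).  If `μ(x ↔ b) ≤ μ(y ↔ b)` for `μ = prodBernoulli w`, then
`μ(x ↔ b, x ↮ y) ≤ μ(y ↔ b, x ↮ y)`: on `{x ↔ y}` the events `{x ↔ b}` and `{y ↔ b}` coincide, so
`μ(x ↔ b) − μ(x ↔ b, x ↮ y) = μ(x ↔ y ↔ b) = μ(y ↔ b) − μ(y ↔ b, x ↮ y)`; subtract.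
[cite: KozmaNitzan2024, Lemma 3 (pp. 6–7)] -/
theorem stub_exchangePlain_c7 : ∀ (n : ℕ) (w : Sym2 (Fin n) → unitInterval) (x y b : Fin n),
    (prodBernoulli w).real (openConn x b) ≤ (prodBernoulli w).real (openConn y b) →
    (prodBernoulli w).real (openConn x b ∩ (openConn x y)ᶜ) ≤
      (prodBernoulli w).real (openConn y b ∩ (openConn x y)ᶜ) := by
  intro n w x y b hle
  have hDm : MeasurableSet ((openConn x y)ᶜ : Set (BondConfig (Fin n))) :=
    MeasurableSet.of_discrete
  have hs1 := measureReal_inter_add_sdiff (μ := prodBernoulli w) (s := openConn x b) hDm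
  have hs2 := measureReal_inter_add_sdiff (μ := prodBernoulli w) (s := openConn y b) hDm
  rw [exchangePlain_sdiff_eq x y b] at hs1
  linarith

end

end Summit.CriticalPhenomena.PercolationContinuityZ3.Theorems
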